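import Summits.QuantumFields.YangMills.Theorems.LuscherReductionDressedRitzPolyakovLiftUniversality
import Summits.QuantumFields.YangMills.Theorems.LuscherReductionOneSiteLevelsGnPullback
import Summits.QuantumFields.YangMills.Theorems.LuscherReductionOneSiteLevelsKacDefs
import Literature.Analysis.OperatorTheory.YangMillsMatrixModelRadialCutoff
import HarnessLib

/-!
# Route `LuscherReduction`, item `DressedRitz` (stmt-QuantumFields-20205), line «polyakovlift» — EXPLICIT TRANSPLANTED OBSERVABLES (skeleton r6 objects)

Support DEFINITIONS (LEAD prover ym-lead-20205-polyakovlift g2; `--supports stmt-QuantumFields-20205`).  The r5 skeleton reads the one-site eigen-RATIOS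
`ψ_{i+1}/ω` of the `B₁ = 2/Λ³` model (exact eigenfunctions, implicitly defined) on the flowed Polyakov loop.  Skeleton r6 replaces them by EXPLICIT
observables: the ratios `χ_R · f_{i+1}/f_0` of Lüscher's matrix-Hamiltonian eigenfunctions (`𝔥 = −½Δ + ¼Σ|x_i × x_j|²` on `ℝ⁹`, colour-invariant sector;
Literature AL1 `LuscherHamiltonianEigenfunctions`, PROVED), cut off at radius `√2·R`, read in the ANGLE-LINEAR link coordinate at scale `Λ/2`:

* `angleRescale μ` — the per-link radial map `y_i ↦ (arctan(μ|y_i|)/(μ|y_i|))·y_i` turning the gnomonic coordinate (`tan θ`) into the angle-linear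
  one (`θ`); `expCoord μ U = angleRescale μ (gnCoord μ U)` — so that `expCoord μ (U^L) = expCoord (μ/L) U` whenever all link angles of `U` are `< π/(2L)`
  (de Moivre; companion file), i.e. the Polyakov power map is an EXACT dilation in this chart;
* `transplantFn R f i` — the flat observable `χ_R · f_{i+1}/f_0` on `ZM = ℝ⁹`; `transplantObs Λ R f i = transplantFn R f i ∘ expCoord (Λ/2)`;
* `TransplantBasis k Λ g` — the r6 BASIS PREDICATE: `g_i = transplantObs Λ R f i` for some AL1 eigenfamily `f` (of size `k+1`, with POSITIVE ground state
  `f_0`) and some cut-off radius `1 ≤ R ≤ 1/(4Λ)` (inside the chart);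
* `basisPhys_transplantBasis` — its members are physical one-site functions (gauge invariance from colour-rotation invariance of `f_j`, `χ_R` and the
  `SO(3)`-equivariance of both charts; zero flux because the gnomonic coordinate is blind to the centre).

WHY (design memo `R6-DESIGN.md` on the item): at the one-site coupling `B = 2L³/Λ³` the bare parameter `λ_b = Λ/L → 0` as `L → ∞`, so the shadow clauses
(o0′)(o5′)(o6′) for transplanted observables follow from the tree's FIRST-MOMENT quasimode bounds (`qform_gnTrial_ge`) + ONE + the adapted eigen-sequence,
whereas for exact `B₁`-eigen-ratios they require eigenvector control at the FIXED coupling `B₁` beyond min–max technology.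

HONEST FRAMING: definitions only (conditional femto rung R2b1); nothing here bears on infinite volume, the continuum limit or the Clay gap.
References: M. Lüscher, NPB 219 (1983) 233 [cite: Luscher1983, §2–§3]; Reed–Simon IV [cite: ReedSimonIV1978, Thm. XIII.64].
-/

set_option autoImplicit false

noncomputable section

open MeasureTheory Filter Topology Real
open Literature.MathematicalPhysics.QuantumFieldTheory (GaugeConfig Site gaugeTransform)
open Literature.Analysis.OperatorTheory.YMMatrixModel
open scoped BigOperators

namespace Summit.QuantumFields.YangMills.Theorems.FemtoTransferGap.PolyakovLift

open Summit.QuantumFields.YangMills.Theorems.FemtoTransferGap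

/-! ## §1 The angle-linear link coordinate -/

/-- Squared Euclidean length of the colour vector of link `i`: `Σ_a y_{(i,a)}²`. [folklore] -/
def linkNormSq (y : ZM) (i : Fin 3) : ℝ := ∑ a : Fin 3, y (i, a) ^ 2

/-- `linkNormSq ≥ 0`. [folklore] -/
theorem linkNormSq_nonneg (y : ZM) (i : Fin 3) : 0 ≤ linkNormSq y i :=
  Finset.sum_nonneg fun _ _ => sq_nonneg _

/-- The profile `arctan r / r` (value `1` at `r = 0`): the radial factor from the gnomonic (`tan θ`) to the angle (`θ`) coordinate. [folklore] -/
def atanc (r : ℝ) : ℝ := if r = 0 then 1 else Real.arctan r / r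

/-- For `r > 0`: `0 < arctan r / r ≤ 1` (`x < tan x` on `(0, π/2)` at `x = arctan r`). [folklore] -/
theorem arctan_div_pos_le_one {r : ℝ} (hr : 0 < r) : 0 < Real.arctan r / r ∧ Real.arctan r / r ≤ 1 := by
  have h1 : 0 < Real.arctan r := Real.arctan_pos.mpr hr
  have h2 : Real.arctan r < r := by
    have h := Real.lt_tan h1 (Real.arctan_lt_pi_div_two r)
    rwa [Real.tan_arctan] at h
  exact ⟨div_pos h1 hr, (div_le_one hr).mpr h2.le⟩

/-- `0 < atanc r ≤ 1`. [folklore] -/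
theorem atanc_pos_le_one (r : ℝ) : 0 < atanc r ∧ atanc r ≤ 1 := by
  unfold atanc
  split_ifs with h
  · exact ⟨one_pos, le_rfl⟩
  · rcases lt_or_gt_of_ne h with hr | hr
    · have e : Real.arctan r / r = Real.arctan (-r) / (-r) := by rw [Real.arctan_neg, neg_div_neg_eq]
      rw [e]; exact arctan_div_pos_le_one (neg_pos.mpr hr)
    · exact arctan_div_pos_le_one hr

/-- `atanc` is measurable. [folklore] -/
theorem measurable_atanc : Measurable atanc :=
  Measurable.ite (measurableSet_singleton 0) measurable_const (Real.continuous_arctan.measurable.div measurable_id)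

/-- The per-link ANGLE RESCALING at scale `μ`: `y_i ↦ (arctan(μ|y_i|)/(μ|y_i|)) · y_i`. [folklore] -/
def angleRescale (μ : ℝ) (y : ZM) : ZM :=
  WithLp.toLp 2 fun p : Fin 3 × Fin 3 => atanc (μ * Real.sqrt (linkNormSq y p.1)) * y p

/-- Coordinates of `angleRescale`. [folklore] -/
@[simp] theorem angleRescale_apply (μ : ℝ) (y : ZM) (p : Fin 3 × Fin 3) :
    angleRescale μ y p = atanc (μ * Real.sqrt (linkNormSq y p.1)) * y p := rfl

/-- The ANGLE-LINEAR (exponential) one-site coordinate at scale `μ`: `expCoord μ = angleRescale μ ∘ gnCoord μ` — link `U_i = cos θ_i + i sin θ_i n_i·σ`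
(`θ_i ∈ [0, π/2]` for the class `±U_i`) is sent to `θ_i n_i / μ`. [cite: Luscher1983, §2] -/
def expCoord (μ : ℝ) (U : Cfg) : ZM := angleRescale μ (gnCoord μ U)

/-! ## §2 Equivariance, measurability -/

/-- `linkNormSq y i = x_i · x_i` for the colour vector `x_i = colourVec y i`. [folklore] -/
theorem linkNormSq_eq_dot (y : ZM) (i : Fin 3) : linkNormSq y i = colourVec y i ⬝ᵥ colourVec y i := by
  simp only [linkNormSq, dotProduct, colourVec, sq]

/-- Colour rotations preserve the per-link lengths. [folklore] -/
theorem linkNormSq_colourRotate {M : Matrix (Fin 3) (Fin 3) ℝ} (hM : M ∈ Matrix.specialOrthogonalGroup (Fin 3) ℝ) (y : ZM) (i : Fin 3) :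
    linkNormSq (colourRotate M y) i = linkNormSq y i := by
  rw [linkNormSq_eq_dot, linkNormSq_eq_dot, dot_colourRotate (mem_orthogonalGroup_of_mem_specialOrthogonalGroup hM)]

/-- `angleRescale μ` commutes with colour rotations (a per-link RADIAL map). [folklore] -/
theorem angleRescale_colourRotate {M : Matrix (Fin 3) (Fin 3) ℝ} (hM : M ∈ Matrix.specialOrthogonalGroup (Fin 3) ℝ) (μ : ℝ) (y : ZM) :
    angleRescale μ (colourRotate M y) = colourRotate M (angleRescale μ y) := by
  ext p
  rw [angleRescale_apply, linkNormSq_colourRotate hM, colourRotate_apply, colourRotate_apply, Finset.mul_sum]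
  refine Finset.sum_congr rfl fun b _ => ?_
  rw [angleRescale_apply]
  ring

/-- `angleRescale μ` is measurable. [folklore] -/
theorem measurable_angleRescale (μ : ℝ) : Measurable (angleRescale μ) := by
  refine (PiLp.continuous_toLp 2 _).measurable.comp (measurable_pi_lambda _ fun p => ?_)
  have hn : Measurable fun y : ZM => linkNormSq y p.1 := by
    unfold linkNormSq
    exact Finset.measurable_sum _ fun a _ => ((PiLp.continuous_apply 2 _ (p.1, a)).measurable).pow_const 2
  exact (measurable_atanc.comp ((hn.sqrt).const_mul μ)).mul (PiLp.continuous_apply 2 _ p).measurable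

/-- A colour-invariant function stays colour-invariant after the angle rescaling. [folklore] -/
theorem isGaugeInv_comp_angleRescale {G : ZM → ℝ} (hG : IsGaugeInv G) (μ : ℝ) : IsGaugeInv (G ∘ angleRescale μ) :=
  fun M hM y => by simp only [Function.comp_apply, angleRescale_colourRotate hM, hG M hM]

/-! ## §3 The transplanted observables and the r6 basis predicate -/

variable {k : ℕ}

/-- The flat observable `χ_R · f_{i+1} / f_0` on `ZM = ℝ⁹` (`χ_R = radialCutoff R`, support `‖y‖ ≤ √2 R`). [cite: Luscher1983, §2] -/
def transplantFn (R : ℝ) (f : Fin (k + 1) → ZM → ℝ) (i : Fin k) : ZM → ℝ :=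
  fun y => radialCutoff R y * (f i.succ y / f 0 y)

/-- The transplanted one-site observable `g_i = (χ_R · f_{i+1}/f_0) ∘ expCoord (Λ/2)`. [cite: Luscher1983, §2–§3] -/
def transplantObs (Λ R : ℝ) (f : Fin (k + 1) → ZM → ℝ) (i : Fin k) : Cfg → ℝ :=
  fun U => transplantFn R f i (expCoord (Λ / 2) U)

/-- ★ **The r6 basis predicate `TransplantBasis k Λ g`**: `g_i = transplantObs Λ R f i` for an AL1 eigenfamily `f_0, …, f_k` of Lüscher's matrix Hamiltonian
(smooth, colour-invariant, `L²`-orthonormal, `𝔥 f_j = physLevel (j+1) · f_j`, `ExpDecay₂`) whose ground state is POSITIVE, and a cut-off radius `1 ≤ R ≤ 1/(4Λ)`.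
[cite: ReedSimonIV1978, Thm. XIII.64] [cite: Luscher1983, §2–§3] -/
def TransplantBasis (k : ℕ) (Λ : ℝ) (g : Fin k → (Cfg → ℝ)) : Prop :=
  ∃ (f : Fin (k + 1) → ZM → ℝ) (R : ℝ), IsEigenFamily k f ∧ (∀ x, 0 < f 0 x) ∧ 1 ≤ R ∧ R * Λ ≤ 1 / 4 ∧
    ∀ i : Fin k, g i = transplantObs Λ R f i

/-! ## §4 Members are physical -/

/-- The flat observable is continuous (`f_0 > 0`, everything smooth). [folklore] -/
theorem continuous_transplantFn (R : ℝ) {f : Fin (k + 1) → ZM → ℝ} (hf : IsEigenFamily k f) (hpos : ∀ x, 0 < f 0 x) (i : Fin k) :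
    Continuous (transplantFn R f i) := by
  have hc : ∀ j, Continuous (f j) := fun j => (hf.1 j 0).continuous
  unfold transplantFn
  exact ((radialCutoff_contDiff R (n := 0)).continuous).mul ((hc _).div (hc 0) fun x => (hpos x).ne')

/-- The flat observable is compactly supported (inside the support of `χ_R`). [folklore] -/
theorem hasCompactSupport_transplantFn {R : ℝ} (hR : 0 < R) (f : Fin (k + 1) → ZM → ℝ) (i : Fin k) :
    HasCompactSupport (transplantFn R f i) :=
  (radialCutoff_hasCompactSupport hR).mul_right

/-- The flat observable is measurable, bounded and colour-invariant (continuity on a compact support; `f_0 > 0`). [folklore] -/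
theorem transplantFn_props {R : ℝ} (hR : 0 < R) {f : Fin (k + 1) → ZM → ℝ} (hf : IsEigenFamily k f) (hpos : ∀ x, 0 < f 0 x) (i : Fin k) :
    Measurable (transplantFn R f i) ∧ (∃ C : ℝ, ∀ y, |transplantFn R f i y| ≤ C) ∧ IsGaugeInv (transplantFn R f i) := by
  have hc := continuous_transplantFn R hf hpos i
  refine ⟨hc.measurable, ?_, fun M hM y => ?_⟩
  · obtain ⟨C, hC⟩ := (hc.norm).bddAbove_range_of_hasCompactSupport (hasCompactSupport_transplantFn hR f i).norm
    exact ⟨C, fun y => by simpa [Real.norm_eq_abs] using hC (Set.mem_range_self y)⟩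
  · simp only [transplantFn, isGaugeInv_radialCutoff R M hM y, hf.2.1 _ M hM y]

/-- ★ Every member of a transplant basis is a physical one-site function. [cite: Luscher1983, §2–§3] -/
theorem basisPhys_transplantBasis (k : ℕ) :
    ∀ (Λ : ℝ) (g : Fin k → (Cfg → ℝ)), TransplantBasis k Λ g → ∀ i, IsPhys (g i) := by
  intro Λ g hg i
  obtain ⟨f, R, hf, hpos, hR1, -, hgi⟩ := hg
  obtain ⟨hm, hb, hinv⟩ := transplantFn_props (lt_of_lt_of_le one_pos hR1) hf hpos i
  rw [hgi i]
  show IsPhys (fun U : Cfg => (transplantFn R f i ∘ angleRescale (Λ / 2)) (gnCoord (Λ / 2) U))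
  refine isPhys_gnPullback (hm.comp (measurable_angleRescale _)) ?_ (isGaugeInv_comp_angleRescale hinv _) _
  obtain ⟨C, hC⟩ := hb
  exact ⟨C, fun y => hC _⟩

end Summit.QuantumFields.YangMills.Theorems.FemtoTransferGap.PolyakovLift

end
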